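import Summits.CriticalPhenomena.CardyFormulaZ2.Theorems.CardyIKTransportCornerLineDescentCrudeContinuity
import Literature.Probability.Percolation.QuadCrossingContinuityEventsDischarge

/-!
# Mesh-uniform stability of crude bond-`ℤ²` crossing probabilities under small deformations of the domain

Support file (`--supports stmt-CriticalPhenomena-10964`) for the line `symmetric-seed-second-order` of the crux
`CardyIKTransport.CornerLineDescent`, lead c4 reshape (checked skeleton
`Cruxes/CornerLineDescent/Lines/symmetric_seed_second_order.lean`): the registered stub `stub_DomainPerturbation`.

THE STATEMENT.  For every conformal rectangle `R` and every `ε > 0` there is `η > 0` such that for every homeomorphism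
`T` of the plane moving no point of the closed unit neighbourhood `cthickening 1 (closure R.carrier)` by more than `η`,
the crude standard bond-`ℤ²` crossing probabilities (`bondStdCrossingProb`, the crux's consequent family) of the image
rectangle `R.map T` and of `R` differ by at most `ε` for all small meshes `δ`.  This is the percolation half of the
line's reduction "Cardy for crude bond-`ℤ²` crossings on TAME rectangles ⇒ on all rectangles" (the other half,
`stub_TameShrink`, produces tame `R.map T` with the same conformal modulus and `T` arbitrarily close to the identity).

THE PROOF (Schramm–Smirnov 2011 §5 technology, all inputs landed).  Let `Φ` be a square model of `R`
(`exists_isSquareModel`) and `Ψ = Freeze.tmodel Φ` its transpose, `Q₀ = Ψ([-1,1]²)` the model chart quad.  Then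
`Φ.trans T` is a square model of `R.map T` (`Freeze.isSquareModel_map`) with transpose `T ∘ Ψ`.  Schramm–Smirnov's
discrete estimate (5.1) at `Q₀` (`Quad.continuity_of_lemma_5_1` ∘ `SchrammSmirnov2011_lemma_5_1_holds`) gives quads
`Q' < Q₀ < Q''` with `P_{1/2}[Q' crossed ∧ ¬ Q'' crossed] ≤ ε` for small meshes; strict domination is open in the
uniform metric (`Freeze.exists_radius_left/right`), and the short-fat / long-thin chart quads of BOTH charts `Ψ` and
`T ∘ Ψ` are uniformly close to `Q₀` — those of `Ψ` by uniform continuity (`Freeze.dist_chartQuad_le`), those of `T ∘ Ψ`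
because in addition `T` moves the points of `Ψ([-1-s,1+s]²) ⊆ cthickening 1 (closure R)` by at most `η`
(`Freeze.dist_chartQuad_chartQuad_le`).  The landed sandwiches (`crude_subset_upperCrossing`,
`upperCrossing_subset_fatQuad_crossing`, `thinQuad_crossing_subset_lowerCrossing`,
`Freeze.lowerCrossing_subset_embDomainCrossing`), applied to `R` and to `R.map T`, then give
`crude(R.map T) ⊆ crude(R) ∪ E ∪ (non-lattice)` and symmetrically, whence the claim.
References: O. Schramm, S. Smirnov, Ann. Probab. 39 (2011), §1.3, Lemma 5.1, eq. (5.1); route file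
`Theses/CardyIKTransport.lean` (item 10964).
-/

noncomputable section

namespace Summit.CriticalPhenomena.CardyFormulaZ2.Theorems.CornerLineDescent.SymmetricSeed

open scoped Topology unitInterval ENNReal
open Filter Set Function Metric MeasureTheory
open Literature.Probability.Percolation (IsSquareModel exists_isSquareModel unitSquareQuad unitSquareQuad_carrier
  BondConfig openEdgeUnion openCrossing openConnIn bondPercolation half embDomainCrossing)
open Literature.Probability.Percolation.QuadCrossing (Quad)
open Literature.Probability.Percolation.QuadCrossing.Quad (rectChart rectChart_re_im Dominated StrictlyDominated)
open Literature.Probability.LatticeModels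
open Literature.Probability.RandomPlanarGeometry

namespace Freeze

/-! ## Square models of image rectangles and distances of chart quads of two charts -/

/-- A square model `Φ` of `R` composed with a plane homeomorphism `T` is a square model of the image rectangle
`R.map T` (images of images). [folklore] -/
theorem isSquareModel_map {R : ConformalRectangle} {Φ : ℂ ≃ₜ ℂ} (hΦ : IsSquareModel R Φ) (T : ℂ ≃ₜ ℂ) :
    IsSquareModel (R.map T) (Φ.trans T) where
  image_carrier := by
    rw [show ⇑(Φ.trans T) = T ∘ Φ from rfl, Set.image_comp, hΦ.image_carrier, MarkedDomain.carrier_map]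
  image_arc k := by
    rw [show ⇑(Φ.trans T) = T ∘ Φ from rfl, Set.image_comp, hΦ.image_arc k, MarkedDomain.arc_map]

/-- The transposed model of a composite chart is the composite of the transposed model. [folklore] -/
theorem tmodel_trans_apply (Φ T : ℂ ≃ₜ ℂ) (z : ℂ) : tmodel (Φ.trans T) z = T (tmodel Φ z) := rfl

/-- CHART QUADS OF TWO CHARTS OVER THE SAME RECTANGLE are at uniform distance `≤ η` as soon as the two charts are
pointwise `η`-close on the rectangle. [folklore] -/
theorem dist_chartQuad_chartQuad_le (Ψ Ψ' : ℂ ≃ₜ ℂ) {η : ℝ} (hη : 0 ≤ η) {x₀ x₁ y₀ y₁ : ℝ} (hx : x₀ < x₁)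
    (hy : y₀ < y₁) (h : ∀ p : I × I, dist (Ψ' (rectChart x₀ x₁ y₀ y₁ p)) (Ψ (rectChart x₀ x₁ y₀ y₁ p)) ≤ η) :
    dist (chartQuad Ψ' x₀ x₁ y₀ y₁ hx hy) (chartQuad Ψ x₀ x₁ y₀ y₁ hx hy) ≤ η := by
  rw [Quad.dist_eq, ContinuousMap.dist_le hη]
  exact h

/-- The points of the model chart quad `Ψ([-1,1]²)` lie in the closed domain. [folklore] -/
theorem chartQuad_unit_apply_mem {R : ConformalRectangle} {Φ : ℂ ≃ₜ ℂ} (hΦ : IsSquareModel R Φ) (p : I × I) :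
    chartQuad (tmodel Φ) (-1) 1 (-1) 1 (by norm_num) (by norm_num) p ∈ closure R.carrier := by
  rw [← tmodel_image_Icc hΦ, chartQuad_apply]
  refine mem_image_of_mem _ ?_
  obtain ⟨e1, e2⟩ := rectChart_re_im (-1) 1 (-1) 1 p
  have hs0 : (0 : ℝ) ≤ p.1 := p.1.2.1
  have hs1 : (p.1 : ℝ) ≤ 1 := p.1.2.2
  have ht0 : (0 : ℝ) ≤ p.2 := p.2.2.1
  have ht1 : (p.2 : ℝ) ≤ 1 := p.2.2.2
  rw [Complex.mem_reProdIm, e1, e2]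
  constructor <;> constructor <;> nlinarith

/-- TRANSFER OF CLOSENESS TO THE DEFORMED CHART.  If a chart quad of `Ψ` is within `a ≤ 1` of the model quad
`Q₀ = Ψ([-1,1]²)` of a square model of `R`, and `T` moves the points of `cthickening 1 (closure R)` by at most `η`, then
the same chart quad of `T ∘ Ψ` is within `η + a` of `Q₀`. [folklore] -/
theorem dist_chartQuad_trans_le {R : ConformalRectangle} {Φ : ℂ ≃ₜ ℂ} (hΦ : IsSquareModel R Φ) (T : ℂ ≃ₜ ℂ)
    {η a : ℝ} (hη : 0 ≤ η) (ha : a ≤ 1) (hT : ∀ z ∈ cthickening 1 (closure R.carrier), dist (T z) z ≤ η)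
    {x₀ x₁ y₀ y₁ : ℝ} (hx : x₀ < x₁) (hy : y₀ < y₁)
    (hd : dist (chartQuad (tmodel Φ) x₀ x₁ y₀ y₁ hx hy)
      (chartQuad (tmodel Φ) (-1) 1 (-1) 1 (by norm_num) (by norm_num)) ≤ a) :
    dist (chartQuad (tmodel (Φ.trans T)) x₀ x₁ y₀ y₁ hx hy)
      (chartQuad (tmodel Φ) (-1) 1 (-1) 1 (by norm_num) (by norm_num)) ≤ η + a := by
  refine (dist_triangle _ (chartQuad (tmodel Φ) x₀ x₁ y₀ y₁ hx hy) _).trans (add_le_add ?_ hd)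
  refine dist_chartQuad_chartQuad_le _ _ hη hx hy fun p => hT _ ?_
  refine mem_cthickening_of_dist_le _ _ 1 _ (chartQuad_unit_apply_mem hΦ p) ?_
  exact ((Quad.dist_apply_le (chartQuad (tmodel Φ) x₀ x₁ y₀ y₁ hx hy)
    (chartQuad (tmodel Φ) (-1) 1 (-1) 1 (by norm_num) (by norm_num)) p).trans hd).trans ha

end Freeze

/-! ## The stub -/

/-- REGISTERED STUB `stub_DomainPerturbation` (line `symmetric-seed-second-order`, lead c4): MESH-UNIFORM STABILITY OF
CRUDE BOND-`ℤ²` CROSSING PROBABILITIES UNDER SMALL DEFORMATIONS OF THE DOMAIN.  For every conformal rectangle `R` and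
`ε > 0` there is `η > 0` such that for every plane homeomorphism `T` with `dist (T z) z ≤ η` on
`cthickening 1 (closure R.carrier)`, eventually as the mesh `δ → 0⁺`,
`|bondStdCrossingProb (R.map T) δ − bondStdCrossingProb R δ| ≤ ε`.  Proof: Schramm–Smirnov (5.1) at the model chart quad
of a square model of `R`, openness of the strict order, the sandwiches for `R` and for `R.map T` (model `Φ.trans T`),
see the module docstring. [folklore] -/
theorem stub_DomainPerturbation :
    ∀ (R : ConformalRectangle) (ε : ℝ), 0 < ε → ∃ η : ℝ, 0 < η ∧ ∀ T : ℂ ≃ₜ ℂ,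
      (∀ z ∈ Metric.cthickening 1 (closure R.carrier), dist (T z) z ≤ η) →
        ∀ᶠ δ in 𝓝[>] (0:ℝ), |bondStdCrossingProb (R.map T) δ - bondStdCrossingProb R δ| ≤ ε := by
  intro R ε hε
  obtain ⟨Φ, hΦ⟩ := exists_isSquareModel R
  -- Schramm–Smirnov (5.1) at the model chart quad, and the two domination radii
  obtain ⟨Q', Q'', hQ', hQ'', δ₀, hδ₀, hE⟩ :=
    Literature.Probability.Percolation.QuadCrossing.Quad.continuity_of_lemma_5_1
      Literature.Probability.Percolation.QuadCrossing.SchrammSmirnov2011_lemma_5_1_holds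
      (Freeze.chartQuad (Freeze.tmodel Φ) (-1) 1 (-1) 1 (by norm_num) (by norm_num)) (ENNReal.ofReal ε)
      (ENNReal.ofReal_pos.2 hε)
  obtain ⟨r₁, hr₁, hdom₁⟩ := Freeze.exists_radius_left hQ'
  obtain ⟨r₂, hr₂, hdom₂⟩ := Freeze.exists_radius_right hQ''
  set r : ℝ := min (min r₁ r₂) 1 with hrdef
  have hr : 0 < r := lt_min (lt_min hr₁ hr₂) one_pos
  have hr1 : r ≤ 1 := min_le_right _ _
  have hrr₁ : r ≤ r₁ := (min_le_left _ _).trans (min_le_left _ _)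
  have hrr₂ : r ≤ r₂ := (min_le_left _ _).trans (min_le_right _ _)
  have hr4 : 0 < r / 4 := by positivity
  obtain ⟨θ, hθ, hmod⟩ := Freeze.exists_modulus (Freeze.tmodel Φ) hr4
  refine ⟨r / 4, hr4, fun T hT => ?_⟩
  -- the width parameter `s`
  set s : ℝ := min (1 / 2) (θ / 4) with hsdef
  have hs : 0 < s := lt_min one_half_pos (by positivity)
  have hs1 : s ≤ 1 / 2 := min_le_left _ _
  have hsθ : 4 * s ≤ θ := by rw [hsdef]; linarith [min_le_right (1 / 2 : ℝ) (θ / 4)]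
  -- the square model of the image and the sandwich data of both rectangles
  have hΦT : IsSquareModel (R.map T) (Φ.trans T) := Freeze.isSquareModel_map hΦ T
  obtain ⟨g, hg, hup⟩ := upperCrossing_subset_fatQuad_crossing R Φ hΦ s hs hs1
  obtain ⟨t, ht, hts, κ, hκ, rr, hrr, hlow⟩ := thinQuad_crossing_subset_lowerCrossing R Φ hΦ s hs hs1 s hs
  obtain ⟨gT, hgT, hupT⟩ := upperCrossing_subset_fatQuad_crossing (R.map T) (Φ.trans T) hΦT s hs hs1
  obtain ⟨tT, htT, htsT, κT, hκT, rT, hrT, hlowT⟩ :=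
    thinQuad_crossing_subset_lowerCrossing (R.map T) (Φ.trans T) hΦT s hs hs1 s hs
  -- the chart quads of `Ψ` are within `r/4` of the model quad
  have hdistP : dist (Freeze.chartQuad (Freeze.tmodel Φ) (-1 + s) (1 - s) (-1 - s) (1 + s) (by linarith) (by linarith))
      (Freeze.chartQuad (Freeze.tmodel Φ) (-1) 1 (-1) 1 (by norm_num) (by norm_num)) ≤ r / 4 := by
    refine Freeze.dist_chartQuad_le hr4.le hmod _ _ ⟨by linarith, by linarith⟩ ⟨by linarith, by linarith⟩
      ⟨by linarith, by linarith⟩ ⟨by linarith, by linarith⟩ ?_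
    have e1 : -1 + s + 1 = s := by ring
    have e2 : 1 - s - 1 = -s := by ring
    have e3 : -1 - s + 1 = -s := by ring
    have e4 : 1 + s - 1 = s := by ring
    rw [e1, e2, e3, e4, abs_neg, abs_of_pos hs]
    linarith
  have hdistM : ∀ {u : ℝ} (hu : 0 < u) (hus : u ≤ s),
      dist (Freeze.chartQuad (Freeze.tmodel Φ) (-1 - u) (1 + u) (-1 + s) (1 - s) (by linarith) (by linarith))
        (Freeze.chartQuad (Freeze.tmodel Φ) (-1) 1 (-1) 1 (by norm_num) (by norm_num)) ≤ r / 4 := by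
    intro u hu hus
    refine Freeze.dist_chartQuad_le hr4.le hmod _ _ ⟨by linarith, by linarith⟩ ⟨by linarith, by linarith⟩
      ⟨by linarith, by linarith⟩ ⟨by linarith, by linarith⟩ ?_
    have e1 : -1 - u + 1 = -u := by ring
    have e2 : 1 + u - 1 = u := by ring
    have e3 : -1 + s + 1 = s := by ring
    have e4 : 1 - s - 1 = -s := by ring
    rw [e1, e2, e3, e4, abs_neg, abs_neg, abs_of_pos hs, abs_of_pos hu]
    linarith
  -- dominations for `R` (chart `Ψ`) and for `R.map T` (chart `T ∘ Ψ`)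
  have hdomP : Dominated Q' (Freeze.fatQuad (Freeze.tmodel Φ) s) := by
    rw [Freeze.fatQuad_eq _ hs (by linarith)]
    exact hdom₁ _ (lt_of_le_of_lt hdistP (by linarith))
  have hdomM : Dominated (Freeze.thinQuad (Freeze.tmodel Φ) t s) Q'' := by
    rw [Freeze.thinQuad_eq _ ht hs (by linarith)]
    exact hdom₂ _ (lt_of_le_of_lt (hdistM ht hts) (by linarith))
  have hdomPT : Dominated Q' (Freeze.fatQuad (Freeze.tmodel (Φ.trans T)) s) := by
    rw [Freeze.fatQuad_eq _ hs (by linarith)]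
    refine hdom₁ _ (lt_of_le_of_lt (Freeze.dist_chartQuad_trans_le hΦ T hr4.le (by linarith) hT _ _ hdistP) ?_)
    linarith
  have hdomMT : Dominated (Freeze.thinQuad (Freeze.tmodel (Φ.trans T)) tT s) Q'' := by
    rw [Freeze.thinQuad_eq _ htT hs (by linarith)]
    refine hdom₂ _ (lt_of_le_of_lt
      (Freeze.dist_chartQuad_trans_le hΦ T hr4.le (by linarith) hT _ _ (hdistM htT htsT)) ?_)
    linarith
  -- the meshes
  have hδ₁ : 0 < min (min (min (min g rr / 4) (min gT rT / 4)) (δ₀ / 2)) (min κ κT / 2) := by positivity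
  filter_upwards [Ioo_mem_nhdsGT hδ₁] with δ hδ
  rw [mem_Ioo] at hδ
  obtain ⟨hδ, hδ'⟩ := hδ
  have hδgr : δ < min g rr / 4 :=
    hδ'.trans_le ((min_le_left _ _).trans ((min_le_left _ _).trans (min_le_left _ _)))
  have hδgrT : δ < min gT rT / 4 :=
    hδ'.trans_le ((min_le_left _ _).trans ((min_le_left _ _).trans (min_le_right _ _)))
  have hδδ₀ : δ < δ₀ / 2 := hδ'.trans_le ((min_le_left _ _).trans (min_le_right _ _))
  have hδκ : δ < min κ κT / 2 := hδ'.trans_le (min_le_right _ _)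
  have hsq2 : Real.sqrt 2 < 2 := by linarith [Real.sqrt_two_lt_three_halves]
  have hsq0 : 0 < Real.sqrt 2 := Real.sqrt_pos.2 two_pos
  have hm2 : δ * Real.sqrt 2 < 2 * δ := by nlinarith
  have hmpos : 0 < δ * Real.sqrt 2 := by positivity
  have hmδ₀ : δ * Real.sqrt 2 < δ₀ := by linarith
  have hκδ : Real.sqrt 2 * δ ≤ κ := by nlinarith [min_le_left κ κT]
  have hκδT : Real.sqrt 2 * δ ≤ κT := by nlinarith [min_le_right κ κT]
  set ρ : ℝ := min g rr / 2 with hρdef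
  set ρT : ℝ := min gT rT / 2 with hρTdef
  have hρ : 0 ≤ ρ := by positivity
  have hρT : 0 ≤ ρT := by positivity
  have h2δ : 2 * δ ≤ ρ := by rw [hρdef]; linarith
  have h2δT : 2 * δ ≤ ρT := by rw [hρTdef]; linarith
  have hmg : δ * Real.sqrt 2 + ρ ≤ g := by rw [hρdef]; linarith [min_le_left g rr]
  have hmr : δ * Real.sqrt 2 + ρ ≤ rr := by rw [hρdef]; linarith [min_le_right g rr]
  have hmgT : δ * Real.sqrt 2 + ρT ≤ gT := by rw [hρTdef]; linarith [min_le_left gT rT]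
  have hmrT : δ * Real.sqrt 2 + ρT ≤ rT := by rw [hρTdef]; linarith [min_le_right gT rT]
  set m : ℝ := δ * Real.sqrt 2 with hm
  set P := bondPercolation (zdGraph 2) half with hP
  set E : Set (BondConfig (Site 2)) := {ω | (∃ K, Q'.IsCrossing K ∧ K ⊆ openEdgeUnion m ω) ∧
    ¬ ∃ K, Q''.IsCrossing K ∧ K ⊆ openEdgeUnion m ω} with hEdef
  set G : Set (BondConfig (Site 2)) := {ω | ω ⊆ (zdGraph 2).edgeSet} with hGdef
  set A : Set (BondConfig (Site 2)) :=
    embDomainCrossing squareLatticeEmbedding.z R.carrier δ (R.arc 0) (R.arc 2) with hAdef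
  set AT : Set (BondConfig (Site 2)) :=
    embDomainCrossing squareLatticeEmbedding.z (R.map T).carrier δ ((R.map T).arc 0) ((R.map T).arc 2) with hATdef
  -- the two inclusions of events
  have hinclA : AT ⊆ A ∪ (E ∪ Gᶜ) := by
    intro ω hω
    by_cases hωG : ω ⊆ (zdGraph 2).edgeSet
    swap
    · exact Or.inr (Or.inr hωG)
    have hup' : ω ∈ Freeze.upperCrossing (R.map T) ρT δ := crude_subset_upperCrossing (R.map T) ρT δ hδ.le h2δT hω
    obtain ⟨K, hK, hKO⟩ := hupT δ ρT hδ hρT hmgT ω hωG hup'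
    obtain ⟨K', hK'K, hK'⟩ := hdomPT K hK
    by_cases hQ2 : ∃ K, Q''.IsCrossing K ∧ K ⊆ openEdgeUnion m ω
    · obtain ⟨K₂, hK₂, hK₂O⟩ := hQ2
      obtain ⟨K₃, hK₃K, hK₃⟩ := hdomM K₂ hK₂
      exact Or.inl (Freeze.lowerCrossing_subset_embDomainCrossing R hδ hρ hκδ hωG
        (hlow δ ρ hδ hρ hmr ω K₃ hK₃ (hK₃K.trans hK₂O)))
    · exact Or.inr (Or.inl ⟨⟨K', hK', hK'K.trans hKO⟩, hQ2⟩)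
  have hinclB : A ⊆ AT ∪ (E ∪ Gᶜ) := by
    intro ω hω
    by_cases hωG : ω ⊆ (zdGraph 2).edgeSet
    swap
    · exact Or.inr (Or.inr hωG)
    have hup' : ω ∈ Freeze.upperCrossing R ρ δ := crude_subset_upperCrossing R ρ δ hδ.le h2δ hω
    obtain ⟨K, hK, hKO⟩ := hup δ ρ hδ hρ hmg ω hωG hup'
    obtain ⟨K', hK'K, hK'⟩ := hdomP K hK
    by_cases hQ2 : ∃ K, Q''.IsCrossing K ∧ K ⊆ openEdgeUnion m ω
    · obtain ⟨K₂, hK₂, hK₂O⟩ := hQ2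
      obtain ⟨K₃, hK₃K, hK₃⟩ := hdomMT K₂ hK₂
      exact Or.inl (Freeze.lowerCrossing_subset_embDomainCrossing (R.map T) hδ hρT hκδT hωG
        (hlowT δ ρT hδ hρT hmrT ω K₃ hK₃ (hK₃K.trans hK₂O)))
    · exact Or.inr (Or.inl ⟨⟨K', hK', hK'K.trans hKO⟩, hQ2⟩)
  -- the measures
  have hGc : P.real Gᶜ = 0 := by
    rw [measureReal_def, ENNReal.toReal_eq_zero_iff]
    left
    have hae := Literature.Probability.Percolation.ae_subset_edgeSet (zdGraph 2) half
    rw [Filter.Eventually, MeasureTheory.mem_ae_iff] at hae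
    exact hae
  have hEε : P.real E ≤ ε := ENNReal.toReal_le_of_le_ofReal hε.le (hE m hmpos hmδ₀)
  have hEG : P.real (E ∪ Gᶜ) ≤ ε :=
    calc P.real (E ∪ Gᶜ) ≤ P.real E + P.real Gᶜ := measureReal_union_le _ _
      _ ≤ ε := by rw [hGc, add_zero]; exact hEε
  have hA : P.real AT ≤ P.real A + ε :=
    calc P.real AT ≤ P.real (A ∪ (E ∪ Gᶜ)) := measureReal_mono hinclA
      _ ≤ P.real A + P.real (E ∪ Gᶜ) := measureReal_union_le _ _
      _ ≤ P.real A + ε := by gcongr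
  have hB : P.real A ≤ P.real AT + ε :=
    calc P.real A ≤ P.real (AT ∪ (E ∪ Gᶜ)) := measureReal_mono hinclB
      _ ≤ P.real AT + P.real (E ∪ Gᶜ) := measureReal_union_le _ _
      _ ≤ P.real AT + ε := by gcongr
  show |P.real AT - P.real A| ≤ ε
  rw [abs_sub_le_iff]
  constructor <;> linarith

end Summit.CriticalPhenomena.CardyFormulaZ2.Theorems.CornerLineDescent.SymmetricSeed
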